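import Literature.NumberTheory.Sieve.HeathBrownCubicFLAssembly
import Literature.NumberTheory.Sieve.HeathBrownCubicMertensK
import Literature.NumberTheory.Sieve.HeathBrownCubicTypeIHolds
import HarnessLib

/-!
# Heath-Brown's Lemma 3.5 holds (discharge of `HeathBrown2001_lemma_3_5`)

D. R. Heath-Brown, *Primes represented by `x³ + 2y³`*, Acta Math. 186 (2001), 1–84, Lemma 3.5 (p. 13,
proved in §6, pp. 34–39): for `0 < ϖ < 1/5`, `τ = (log log X)^{-ϖ}` and
`exp(−(log X)^{1/3}) ≤ η ≤ 1`,
`∑_{n ≤ n₀} |T^(n)(𝒜) − κT^(n)(ℬ)| ≪ τη²X²/log X`.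

The named fact `HeathBrown2001_lemma_3_5` of `HeathBrownCubicSieveDecomposition` is discharged here by
combining
* `HeathBrown2001_lemma_3_5_of_typeI_A` (`HeathBrownCubicFLAssembly`: the whole of §6 — Fundamental
  Lemma on both sides, exact `𝒜`/`ℬ` reductions, remainders, chain sums, (6.7), and the parameter
  choice — from the Type I bound of Lemma 3.2 and Mertens' theorem for `K`),
* `HeathBrown2001_typeI_A_holds` (`HeathBrownCubicTypeIHolds`: Lemma 3.2), and
* `mertensK_grouped` (`HeathBrownCubicMertensK`: Mertens' theorem for the prime ideals of `K = ℚ(∛2)`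
  with the residue constant, Heath-Brown's (6.9)).
(A separate sibling of `HeathBrownCubicSieveDecompositionProofs`, which is imported by the Type II files
and must not import this chain.)

## References

* D. R. Heath-Brown, *Primes represented by `x³ + 2y³`*, Acta Math. 186 (2001), 1–84, Lemma 3.5 and §6.
  [cite: HeathBrownActa2001, Lemma 3.5 and §6]
-/

noncomputable section

namespace Literature.NumberTheory.Sieve.CubicSieve

/-- **Heath-Brown's Lemma 3.5 holds** (the named fact `HeathBrown2001_lemma_3_5` of
`HeathBrownCubicSieveDecomposition`, discharged). [cite: HeathBrownActa2001, Lemma 3.5] -/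
theorem HeathBrown2001_lemma_3_5_holds : HeathBrown2001_lemma_3_5 :=
  HeathBrown2001_lemma_3_5_of_typeI_A HeathBrown2001_typeI_A_holds mertensK_grouped

end Literature.NumberTheory.Sieve.CubicSieve

end
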